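import Mathlib
import Literature.AlgebraicGeometry.Resolution.KunzRegularityCriterionProofs
import HarnessLib

/-!
# Regularity of a monogenic radicial cover forces `h ∉ 𝔪²`

Topic: `Literature/RingTheory/Derivation`. Let `R → S` be a local homomorphism of regular local
rings of the same dimension `d`, `1, t, …, t^{p-1}` an `R`-basis of `S` (`p ≥ 2`) with `t ∈ 𝔫`,
`t^p = h ∈ R`, and `D` an `R`-derivation of `S` with `D t = 1`. Then `h ∉ 𝔪²`
(`not_mem_maximalIdeal_sq_of_basis_pow`): otherwise the constant-coefficient form `ρ` maps `𝔫²` into `𝔪²`,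
and a linear dependence among the `d + 1` vectors `t, u₁, …, u_d` of `𝔫/𝔫²` (`uᵢ` minimal
generators of `𝔪`) either gives `1 = D t ∈ 𝔫` or, after applying `ρ` and Nakayama, generates
`𝔪` by `d - 1` elements. (The converse direction — `h ∉ 𝔪² ⇒ R[T]/(T^p - h)` regular — is the
"transversal exit" of the resolution literature.) Brick of the rank-`p` Kimura–Niitsuma argument
(Matsumura, *Commutative Ring Theory*, end of §26, with Thm. 14.2).

References: H. Matsumura, *Commutative Ring Theory*, CUP 1986, Thms. 2.2, 14.2, §26. Elementary;
no named facts.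
-/

namespace Literature.RingTheory.Derivation

open Polynomial IsLocalRing Module
open Literature.AlgebraicGeometry.Resolution

/-- **Regularity forces `h ∉ 𝔪²`.** Let `R → S` be a local homomorphism of regular local rings
of the same dimension, `1, t, …, t^{p-1}` an `R`-basis of `S` with `t ∈ 𝔫`, `t^p = h ∈ R`, and
`D` an `R`-derivation of `S` with `D t = 1`. Then `h ∉ 𝔪²`: otherwise the constant-coefficient
form `ρ` maps `𝔫²` into `𝔪²`, and a linear dependence among the `d + 1` vectors
`t, u₁, …, u_d` of `𝔫/𝔫²` either gives `1 = D t ∈ 𝔫` or (applying `ρ`) generates `𝔪` by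
`d - 1` elements. [folklore] -/
theorem not_mem_maximalIdeal_sq_of_basis_pow {R S : Type*} [CommRing R] [IsRegularLocalRing R]
    [CommRing S] [IsRegularLocalRing S] [Algebra R S] [IsLocalHom (algebraMap R S)] {n : ℕ}
    (b : Basis (Fin (n + 2)) R S) {t : S} (hb : ∀ i, b i = t ^ (i : ℕ))
    (htn : t ∈ maximalIdeal S) {h : R} (hth : t ^ (n + 2) = algebraMap R S h)
    (D : Derivation R S S) (hDt : D t = 1) (hdim : ringKrullDim S = ringKrullDim R) :
    h ∉ maximalIdeal R ^ 2 := by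
  classical
  intro hh2
  set 𝔪 := maximalIdeal R with h𝔪
  set 𝔫 := maximalIdeal S with h𝔫
  have hmap : ∀ r ∈ 𝔪, algebraMap R S r ∈ 𝔫 := fun r hr => map_nonunit (algebraMap R S) r hr
  have hrefl : ∀ r : R, algebraMap R S r ∈ 𝔫 → r ∈ 𝔪 := fun r hr =>
    (mem_maximalIdeal _).mpr fun hu => (mem_maximalIdeal _).mp hr (hu.map _)
  -- the coordinate forms `ρ = coord 0`, `ρl = coord (last)`
  set ρ : S →ₗ[R] R := b.coord 0 with hρ
  set ρl : S →ₗ[R] R := b.coord (Fin.last (n + 1)) with hρl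
  have hb0 : b 0 = 1 := by rw [hb 0, Fin.val_zero, pow_zero]
  have hρ1 : ρ 1 = 1 := by
    rw [hρ, ← hb0, Basis.coord_apply, Basis.repr_self, Finsupp.single_eq_same]
  have hρa : ∀ (r : R) (s : S), ρ (algebraMap R S r * s) = r * ρ s := fun r s => by
    rw [← Algebra.smul_def, map_smul, smul_eq_mul]
  -- `ρ (t s) = h · ρl s`
  have hρt : ∀ s : S, ρ (t * s) = h * ρl s := by
    have key : ρ ∘ₗ LinearMap.mulLeft R t = h • ρl := by
      refine b.ext fun i => ?_
      have e1 : t * b i = t ^ ((i : ℕ) + 1) := by rw [hb i, pow_succ']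
      rw [LinearMap.comp_apply, LinearMap.mulLeft_apply, e1, LinearMap.smul_apply, smul_eq_mul]
      by_cases hi : (i : ℕ) + 1 = n + 2
      · have hil : i = Fin.last (n + 1) := Fin.ext (by rw [Fin.val_last]; omega)
        rw [hi, hth, Algebra.algebraMap_eq_smul_one, ← hb0, map_smul, smul_eq_mul, hil, hρ, hρl,
          Basis.coord_apply, Basis.coord_apply, Basis.repr_self, Basis.repr_self,
          Finsupp.single_eq_same, Finsupp.single_eq_same]
      · have hlt : (i : ℕ) + 1 < n + 2 := by omega
        have h1 : t ^ ((i : ℕ) + 1) = b ⟨(i : ℕ) + 1, hlt⟩ := by rw [hb]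
        rw [h1, hρ, hρl, Basis.coord_apply, Basis.coord_apply, Basis.repr_self, Basis.repr_self,
          Finsupp.single_eq_of_ne, Finsupp.single_eq_of_ne, mul_zero]
        · intro heq
          apply hi
          have := congrArg Fin.val heq
          rw [Fin.val_last] at this
          omega
        · intro heq
          have := congrArg Fin.val heq
          simp at this
    intro s
    have := LinearMap.congr_fun key s
    rwa [LinearMap.comp_apply, LinearMap.mulLeft_apply, LinearMap.smul_apply, smul_eq_mul] at this
  -- decomposition `s = ρ(s) + t s'`
  have hdec : ∀ s : S, ∃ s' : S, s = algebraMap R S (ρ s) + t * s' := by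
    intro s
    refine ⟨∑ j : Fin (n + 1), b.repr s j.succ • t ^ (j : ℕ), ?_⟩
    conv_lhs => rw [← b.sum_repr s, Fin.sum_univ_succ]
    rw [hb0, Algebra.algebraMap_eq_smul_one, hρ, Basis.coord_apply, Finset.mul_sum]
    congr 1
    refine Finset.sum_congr rfl fun j _ => ?_
    rw [hb, Fin.val_succ, pow_succ', mul_smul_comm]
  have hρmem : ∀ s ∈ 𝔫, ρ s ∈ 𝔪 := by
    intro s hs
    obtain ⟨s', hs'⟩ := hdec s
    apply hrefl
    have : algebraMap R S (ρ s) = s - t * s' := by rw [eq_sub_iff_add_eq]; exact hs'.symm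
    rw [this]
    exact 𝔫.sub_mem hs (𝔫.mul_mem_right _ htn)
  -- `ρ(𝔫²) ⊆ 𝔪²` (using `h ∈ 𝔪²`)
  have hρsq : ∀ y ∈ 𝔫 ^ 2, ρ y ∈ 𝔪 ^ 2 := by
    intro y hy
    rw [pow_two] at hy
    refine Submodule.mul_induction_on hy (fun m hm m' hm' => ?_) (fun x y hx hy => ?_)
    · obtain ⟨s, hs⟩ := hdec m
      obtain ⟨s', hs'⟩ := hdec m'
      have hc := hρmem m hm
      have hc' := hρmem m' hm'
      have : m * m' = algebraMap R S (ρ m * ρ m') +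
          t * (algebraMap R S (ρ m) * s' + algebraMap R S (ρ m') * s + t * s * s') := by
        conv_lhs => rw [hs, hs']
        rw [map_mul]
        ring
      rw [this, map_add, hρt, Algebra.algebraMap_eq_smul_one, map_smul, hρ1, smul_eq_mul, mul_one]
      exact Ideal.add_mem _ (by rw [pow_two]; exact Ideal.mul_mem_mul hc hc')
        (Ideal.mul_mem_right _ _ hh2)
    · rw [map_add]
      exact Ideal.add_mem _ hx hy
  -- `D(𝔫²) ⊆ 𝔫`
  have hDsq : ∀ y ∈ 𝔫 ^ 2, D y ∈ 𝔫 := by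
    intro y hy
    rw [pow_two] at hy
    refine Submodule.mul_induction_on hy (fun m hm m' hm' => ?_) (fun x y hx hy => ?_)
    · rw [Derivation.leibniz, smul_eq_mul, smul_eq_mul]
      exact Ideal.add_mem _ (Ideal.mul_mem_right _ _ hm) (Ideal.mul_mem_right _ _ hm')
    · rw [map_add]
      exact Ideal.add_mem _ hx hy
  -- units have unit constant coefficient
  have hρunit : ∀ γ : S, IsUnit γ → IsUnit (ρ γ) := by
    intro γ hγ
    by_contra hu
    have h1 : ρ γ ∈ 𝔪 := (mem_maximalIdeal _).mpr hu
    obtain ⟨γ', hγ'⟩ := hdec γ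
    apply (mem_maximalIdeal _).mp _ hγ
    rw [hγ']
    exact Ideal.add_mem _ (hmap _ h1) (Ideal.mul_mem_right _ _ htn)
  -- minimal generators of `𝔪` and dimensions
  set d := 𝔪.spanFinrank with hd
  obtain ⟨u, hu⟩ := Kunz1969.exists_span_range_eq 𝔪
  have hum : ∀ i, u i ∈ 𝔪 := fun i => hu ▸ Ideal.subset_span ⟨i, rfl⟩
  have hdimS : finrank (ResidueField S) (CotangentSpace S) = d := by
    have h1 := (IsRegularLocalRing.iff_finrank_cotangentSpace S).mp ‹_›
    have h2 := (isRegularLocalRing_iff R).mp ‹_›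
    rw [hdim, ← h2] at h1
    exact_mod_cast h1
  -- the `d + 1` vectors `t, u₁, …, u_d` in `𝔫/𝔫²` are dependent
  let mv : Fin (d + 1) → 𝔫 := Fin.cases ⟨t, htn⟩ fun i => ⟨algebraMap R S (u i), hmap _ (hum i)⟩
  have hmv0 : mv 0 = ⟨t, htn⟩ := Fin.cases_zero
  have hmvs : ∀ i, mv (Fin.succ i) = ⟨algebraMap R S (u i), hmap _ (hum i)⟩ :=
    fun i => Fin.cases_succ _
  let x : Fin (d + 1) → CotangentSpace S := fun i => 𝔫.toCotangent (mv i)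
  have hnli : ¬ LinearIndependent (ResidueField S) x := by
    intro hli
    have := hli.fintype_card_le_finrank
    rw [Fintype.card_fin, hdimS] at this
    omega
  obtain ⟨g, hg, i₀, hi₀⟩ := Fintype.not_linearIndependent_iff.mp hnli
  choose γ hγ using fun i => residue_surjective (R := S) (g i)
  have hγu : IsUnit (γ i₀) := by
    by_contra hu
    apply hi₀
    rw [← hγ i₀, residue_eq_zero_iff]
    exact (mem_maximalIdeal _).mpr hu
  -- the relation `y = γ₀ t + Σ γᵢ uᵢ ∈ 𝔫²`
  set y : S := γ 0 * t + ∑ i : Fin d, γ i.succ * algebraMap R S (u i) with hy_def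
  have hy : y ∈ 𝔫 ^ 2 := by
    have h1 : ∑ i, g i • x i = 𝔫.toCotangent (∑ i, γ i • mv i) := by
      rw [map_sum]
      refine Finset.sum_congr rfl fun i _ => ?_
      rw [map_smul, ← hγ i]
      rfl
    rw [hg, eq_comm, Ideal.toCotangent_eq_zero] at h1
    have h2 : ((∑ i, γ i • mv i : 𝔫) : S) = y := by
      rw [Submodule.coe_sum, Fin.sum_univ_succ, hmv0, hy_def]
      simp only [hmvs, Submodule.coe_smul, smul_eq_mul]
    rwa [h2] at h1
  -- case analysis on the unit coefficient
  revert hγu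
  refine Fin.cases ?_ (fun j => ?_) i₀
  · -- `γ 0` is a unit: apply `D`
    intro hγu
    have h1 := hDsq y hy
    have h2 : D y = γ 0 + (t * D (γ 0) + ∑ i : Fin d, algebraMap R S (u i) * D (γ i.succ)) := by
      rw [hy_def, map_add, map_sum, Derivation.leibniz, hDt, smul_eq_mul, smul_eq_mul, mul_one]
      simp only [Derivation.leibniz, Derivation.map_algebraMap, smul_eq_mul, mul_zero, zero_add]
      ring
    apply (mem_maximalIdeal _).mp _ hγu
    have h3 : γ 0 = D y - (t * D (γ 0) + ∑ i : Fin d, algebraMap R S (u i) * D (γ i.succ)) := by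
      rw [h2]; ring
    rw [h3]
    refine Ideal.sub_mem _ h1 (Ideal.add_mem _ (Ideal.mul_mem_right _ _ htn)
      (Ideal.sum_mem _ fun i _ => Ideal.mul_mem_right _ _ (hmap _ (hum i))))
  · -- `γ (j+1)` is a unit: apply `ρ`
    intro hγu
    have ha : IsUnit (ρ (γ j.succ)) := hρunit _ hγu
    have h1 := hρsq y hy
    have h2 : ρ y = h * ρl (γ 0) + ∑ i : Fin d, u i * ρ (γ i.succ) := by
      rw [hy_def, map_add, map_sum, mul_comm (γ 0) t, hρt]
      congr 1
      refine Finset.sum_congr rfl fun i _ => ?_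
      rw [mul_comm, hρa]
    rw [h2] at h1
    have h3 : ∑ i : Fin d, u i * ρ (γ i.succ) ∈ 𝔪 ^ 2 := by
      have := Ideal.sub_mem _ h1 (Ideal.mul_mem_right (ρl (γ 0)) _ hh2)
      rwa [add_sub_cancel_left] at this
    set N : Ideal R := Ideal.span (u '' ↑(Finset.univ.erase j)) with hN
    have hNle : N ≤ 𝔪 := by
      rw [hN, Ideal.span_le]
      rintro _ ⟨i, -, rfl⟩
      exact hum i
    have huj : u j ∈ N ⊔ 𝔪 ^ 2 := by
      have h4 : u j * ρ (γ j.succ) + ∑ i ∈ Finset.univ.erase j, u i * ρ (γ i.succ) =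
          ∑ i : Fin d, u i * ρ (γ i.succ) :=
        Finset.add_sum_erase Finset.univ (fun i => u i * ρ (γ i.succ)) (Finset.mem_univ j)
      have h5 : ∑ i ∈ Finset.univ.erase j, u i * ρ (γ i.succ) ∈ N :=
        Ideal.sum_mem _ fun i hi => Ideal.mul_mem_right _ _ (Ideal.subset_span ⟨i, hi, rfl⟩)
      have h6 : u j * ρ (γ j.succ) ∈ N ⊔ 𝔪 ^ 2 := by
        rw [eq_sub_of_add_eq h4]
        exact Ideal.sub_mem _ (Ideal.mem_sup_right h3) (Ideal.mem_sup_left h5)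
      have h7 : u j = u j * ρ (γ j.succ) * ↑(ha.unit⁻¹) := by
        rw [mul_assoc, IsUnit.mul_val_inv, mul_one]
      rw [h7]
      exact Ideal.mul_mem_right _ _ h6
    have hle : 𝔪 ≤ N ⊔ 𝔪 • 𝔪 := by
      rw [Ideal.smul_eq_mul, ← pow_two]
      conv_lhs => rw [← hu]
      rw [Ideal.span_le]
      rintro _ ⟨i, rfl⟩
      by_cases hij : i = j
      · rw [hij]; exact huj
      · exact Ideal.mem_sup_left
          (Ideal.subset_span ⟨i, Finset.mem_erase.mpr ⟨hij, Finset.mem_univ i⟩, rfl⟩)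
    have hNak : 𝔪 ≤ N := Submodule.le_of_le_smul_of_le_jacobson_bot (IsNoetherian.noetherian 𝔪)
      (IsLocalRing.maximalIdeal_le_jacobson ⊥) hle
    have heq : N = 𝔪 := le_antisymm hNle hNak
    have hfin : (u '' ↑(Finset.univ.erase j)).Finite := (Finset.finite_toSet _).image u
    have hcard : 𝔪.spanFinrank ≤ d - 1 := by
      rw [← heq, hN]
      refine (Submodule.spanFinrank_span_le_ncard_of_finite hfin).trans ?_
      refine (Set.ncard_image_le (Finset.finite_toSet _)).trans ?_
      rw [Set.ncard_coe_finset, Finset.card_erase_of_mem (Finset.mem_univ j), Finset.card_univ,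
        Fintype.card_fin]
    have hdpos : 0 < d := Fin.pos j
    omega

end Literature.RingTheory.Derivation
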